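import Literature.Topology.FourManifolds.TautFoliationsRadialSquares
import Mathlib.Analysis.Convex.PathConnected
import Mathlib.Analysis.Normed.Module.Convex
import HarnessLib

/-!
# Path-connectedness of the boundary arcs of radial squares

Sibling of `TautFoliationsRadialSquares.lean`: the path-connected versions of
`isPreconnected_sphere_inter_closedBall` and `isPreconnected_sphere_diff_ball` (the part of a
small boundary square inside a big closed square, resp. outside a big open square, is path
connected when nonempty: a union of at most four convex pieces, the nonempty vertical ones
meeting the nonempty horizontal ones at corners), whence **the contour lines of radial squares
are path connected** (`IsRadial.isPathConnected_levelLine(_floor)`): paths along them are the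
pieces of the loops of the coned fence collar compared with the lifts of the boundary loop.

* `isPathConnected_sphere_inter_closedBall`, `isPathConnected_sphere_diff_ball`,
  `IsRadial.isPathConnected_levelLine`, `IsRadial.isPathConnected_levelLine_floor` (**proved**).

All statements are [folklore].
-/

noncomputable section

open Set Filter Metric Topology Function

namespace Literature.Topology.FourManifolds

namespace ConeSquare

variable {c₀ c : ℝ × ℝ} {ℓ R : ℝ}

/-- Union with a possibly empty path connected set meeting the first set. [folklore] -/
theorem IsPathConnected.union_of_subset_or {X : Type*} [TopologicalSpace X] {U V : Set X} (hU : IsPathConnected U)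
    (hV : V = ∅ ∨ (IsPathConnected V ∧ (U ∩ V).Nonempty)) : IsPathConnected (U ∪ V) := by
  rcases hV with rfl | ⟨hV, hUV⟩
  · rwa [union_empty]
  · exact hU.union hV hUV

/-- **The part of a boundary square inside a bigger closed square is path connected** (when
nonempty, `ℓ < R`). [folklore] -/
theorem isPathConnected_sphere_inter_closedBall (hℓ : 0 < ℓ) (hR : ℓ < R) (hne : (sphere c ℓ ∩ closedBall c₀ R).Nonempty) :
    IsPathConnected (sphere c ℓ ∩ closedBall c₀ R) := by
  set A := sphere c ℓ ∩ closedBall c₀ R with hA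
  -- the pieces: the traces of `A` on the four side lines
  set a : Bool → ℝ := fun b ↦ if b then c.1 + ℓ else c.1 - ℓ with ha
  set b₂ : Bool → ℝ := fun b ↦ if b then c.2 + ℓ else c.2 - ℓ with hb₂
  set V : Bool → Set (ℝ × ℝ) := fun i ↦ A ∩ {x | x.1 = a i} with hV
  set H : Bool → Set (ℝ × ℝ) := fun j ↦ A ∩ {x | x.2 = b₂ j} with hH
  have haℓ : ∀ i, |a i - c.1| = ℓ := fun i ↦ by cases i <;> simp [ha, abs_of_pos hℓ]
  have hbℓ : ∀ j, |b₂ j - c.2| = ℓ := fun j ↦ by cases j <;> simp [hb₂, abs_of_pos hℓ]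
  have hbd : ∀ x ∈ A, |x.1 - c.1| ≤ ℓ ∧ |x.2 - c.2| ≤ ℓ ∧ |x.1 - c₀.1| ≤ R ∧ |x.2 - c₀.2| ≤ R := fun x hx ↦ by
    have h1 := hx.1; rw [mem_sphere, Prod.dist_eq, Real.dist_eq, Real.dist_eq] at h1
    have h2 := mem_closedBall_iff_coord.1 hx.2
    exact ⟨le_of_max_le_left h1.le, le_of_max_le_right h1.le, h2.1, h2.2⟩
  -- `A` is the union of the pieces
  have hcover : A = (V false ∪ V true) ∪ (H false ∪ H true) := by
    apply Subset.antisymm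
    · intro x hx
      rcases (mem_sphere_iff_coord).1 hx.1 with ⟨h1, -⟩ | ⟨h1, -⟩
      · left
        rcases (abs_eq hℓ.le).1 h1 with h | h
        · exact Or.inr ⟨hx, by simp [ha]; linarith⟩
        · exact Or.inl ⟨hx, by simp [ha]; linarith⟩
      · right
        rcases (abs_eq hℓ.le).1 h1 with h | h
        · exact Or.inr ⟨hx, by simp [hb₂]; linarith⟩
        · exact Or.inl ⟨hx, by simp [hb₂]; linarith⟩
    · rintro x ((hx | hx) | (hx | hx)) <;> exact hx.1
  -- convexity of the pieces
  have hAconv_line₁ : ∀ i, Convex ℝ (V i) := fun i ↦ by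
    have : V i = (closedBall c ℓ ∩ closedBall c₀ R) ∩ {x | x.1 = a i} := by
      ext x; simp only [hV, hA, mem_inter_iff, mem_setOf_eq]
      constructor
      · rintro ⟨⟨hs, hb⟩, h1⟩; exact ⟨⟨sphere_subset_closedBall hs, hb⟩, h1⟩
      · rintro ⟨⟨hs, hb⟩, h1⟩
        refine ⟨⟨(mem_sphere_iff_coord).2 (Or.inl ⟨by rw [h1]; exact haℓ i, (mem_closedBall_iff_coord.1 hs).2⟩), hb⟩, h1⟩
    rw [this]
    refine ((convex_closedBall c ℓ).inter (convex_closedBall c₀ R)).inter ?_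
    have : {x : ℝ × ℝ | x.1 = a i} = (fun x : ℝ × ℝ ↦ x.1) ⁻¹' {a i} := rfl
    rw [this]; exact (convex_singleton _).linear_preimage (LinearMap.fst ℝ ℝ ℝ)
  have hAconv_line₂ : ∀ j, Convex ℝ (H j) := fun j ↦ by
    have : H j = (closedBall c ℓ ∩ closedBall c₀ R) ∩ {x | x.2 = b₂ j} := by
      ext x; simp only [hH, hA, mem_inter_iff, mem_setOf_eq]
      constructor
      · rintro ⟨⟨hs, hb⟩, h1⟩; exact ⟨⟨sphere_subset_closedBall hs, hb⟩, h1⟩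
      · rintro ⟨⟨hs, hb⟩, h1⟩
        refine ⟨⟨(mem_sphere_iff_coord).2 (Or.inr ⟨by rw [h1]; exact hbℓ j, (mem_closedBall_iff_coord.1 hs).1⟩), hb⟩, h1⟩
    rw [this]
    refine ((convex_closedBall c ℓ).inter (convex_closedBall c₀ R)).inter ?_
    have : {x : ℝ × ℝ | x.2 = b₂ j} = (fun x : ℝ × ℝ ↦ x.2) ⁻¹' {b₂ j} := rfl
    rw [this]; exact (convex_singleton _).linear_preimage (LinearMap.snd ℝ ℝ ℝ)
  -- corners: nonempty `V i` and nonempty `H j` meet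
  have hcorner : ∀ i j, (V i).Nonempty → (H j).Nonempty → (V i ∩ H j).Nonempty := by
    intro i j ⟨p, hpA, hp1⟩ ⟨p', hp'A, hp'2⟩
    have hp := hbd p hpA; have hp' := hbd p' hp'A
    have hp1' : p.1 = a i := hp1; have hp'2' : p'.2 = b₂ j := hp'2
    set z : ℝ × ℝ := (a i, b₂ j) with hz
    have hzs : z ∈ sphere c ℓ := (mem_sphere_iff_coord).2 (Or.inl ⟨haℓ i, by rw [hbℓ]⟩)
    have hzb : z ∈ closedBall c₀ R := by
      rw [mem_closedBall_iff_coord]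
      exact ⟨by show |a i - c₀.1| ≤ R; rw [← hp1']; exact hp.2.2.1, by show |b₂ j - c₀.2| ≤ R; rw [← hp'2']; exact hp'.2.2.2⟩
    exact ⟨z, ⟨⟨hzs, hzb⟩, rfl⟩, ⟨⟨hzs, hzb⟩, rfl⟩⟩
  -- a nonempty vertical piece and a nonempty horizontal piece (using `ℓ < R`)
  obtain ⟨x, hxA⟩ := hne
  have hx := hbd x hxA
  have hVne : ∃ i, (V i).Nonempty := by
    -- the end of the first coordinate range kept by the big square
    by_cases h : |c.1 - ℓ - c₀.1| ≤ R
    · refine ⟨false, ⟨(c.1 - ℓ, x.2), ⟨(mem_sphere_iff_coord).2 (Or.inl ⟨by simp [abs_of_pos hℓ], hx.2.1⟩), ?_⟩, by simp [ha]⟩⟩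
      rw [mem_closedBall_iff_coord]; exact ⟨h, hx.2.2.2⟩
    · refine ⟨true, ⟨(c.1 + ℓ, x.2), ⟨(mem_sphere_iff_coord).2 (Or.inl ⟨by simp [abs_of_pos hℓ], hx.2.1⟩), ?_⟩, by simp [ha]⟩⟩
      rw [mem_closedBall_iff_coord]
      refine ⟨?_, hx.2.2.2⟩
      rw [abs_le]; rw [abs_le, not_and_or, not_le, not_le] at h
      have h1 := abs_le.1 hx.1; have h3 := abs_le.1 hx.2.2.1
      rcases h with h | h <;> constructor <;> linarith
  have hHne : ∃ j, (H j).Nonempty := by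
    by_cases h : |c.2 - ℓ - c₀.2| ≤ R
    · refine ⟨false, ⟨(x.1, c.2 - ℓ), ⟨(mem_sphere_iff_coord).2 (Or.inr ⟨by simp [abs_of_pos hℓ], hx.1⟩), ?_⟩, by simp [hb₂]⟩⟩
      rw [mem_closedBall_iff_coord]; exact ⟨hx.2.2.1, h⟩
    · refine ⟨true, ⟨(x.1, c.2 + ℓ), ⟨(mem_sphere_iff_coord).2 (Or.inr ⟨by simp [abs_of_pos hℓ], hx.1⟩), ?_⟩, by simp [hb₂]⟩⟩
      rw [mem_closedBall_iff_coord]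
      refine ⟨hx.2.2.1, ?_⟩
      rw [abs_le]; rw [abs_le, not_and_or, not_le, not_le] at h
      have h1 := abs_le.1 hx.2.1; have h3 := abs_le.1 hx.2.2.2
      rcases h with h | h <;> constructor <;> linarith
  obtain ⟨i₀, hi₀⟩ := hVne
  obtain ⟨j₀, hj₀⟩ := hHne
  have hpc : ∀ i, (V i).Nonempty → IsPathConnected (V i) := fun i h ↦ (hAconv_line₁ i).isPathConnected h
  have hpc' : ∀ j, (H j).Nonempty → IsPathConnected (H j) := fun j h ↦ (hAconv_line₂ j).isPathConnected h
  -- assemble: `(V i₀ ∪ H j₀) ∪ V (!i₀) ∪ H (!j₀)`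
  have hP₀ : IsPathConnected (V i₀ ∪ H j₀) := (hpc i₀ hi₀).union (hpc' j₀ hj₀) (hcorner i₀ j₀ hi₀ hj₀)
  have hP₁ : IsPathConnected ((V i₀ ∪ H j₀) ∪ V (!i₀)) := by
    refine IsPathConnected.union_of_subset_or hP₀ ?_
    by_cases h : (V (!i₀)).Nonempty
    · right
      obtain ⟨z, hzV, hzH⟩ := hcorner (!i₀) j₀ h hj₀
      exact ⟨hpc _ h, ⟨z, Or.inr hzH, hzV⟩⟩
    · exact Or.inl (not_nonempty_iff_eq_empty.1 h)
  have hP₂ : IsPathConnected (((V i₀ ∪ H j₀) ∪ V (!i₀)) ∪ H (!j₀)) := by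
    refine IsPathConnected.union_of_subset_or hP₁ ?_
    by_cases h : (H (!j₀)).Nonempty
    · right
      obtain ⟨z, hzV, hzH⟩ := hcorner i₀ (!j₀) hi₀ h
      exact ⟨hpc' _ h, ⟨z, Or.inl (Or.inl hzV), hzH⟩⟩
    · exact Or.inl (not_nonempty_iff_eq_empty.1 h)
  have hunion : (((V i₀ ∪ H j₀) ∪ V (!i₀)) ∪ H (!j₀)) = A := by
    rw [hcover]
    ext y; cases i₀ <;> cases j₀ <;> simp only [Bool.not_false, Bool.not_true, mem_union] <;> tauto
  rw [← hunion]; exact hP₂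

/-- A half-plane piece of the boundary square is a big-square piece, hence path connected
(when nonempty): `{x ∈ sphere c ℓ | A ≤ x.1}`. [folklore] -/
theorem isPathConnected_sphere_inter_fst_ge (hℓ : 0 < ℓ) (A : ℝ) (hne : (sphere c ℓ ∩ {x | A ≤ x.1}).Nonempty) :
    IsPathConnected (sphere c ℓ ∩ {x | A ≤ x.1}) := by
  set N : ℝ := ℓ + |c.1 + ℓ - A| + 1 with hN
  have hNℓ : ℓ < N := by have := abs_nonneg (c.1 + ℓ - A); linarith
  have heq : sphere c ℓ ∩ {x | A ≤ x.1} = sphere c ℓ ∩ closedBall ((A + N, c.2) : ℝ × ℝ) N := by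
    ext x
    simp only [mem_inter_iff, mem_setOf_eq, mem_closedBall_iff_coord]
    constructor
    · rintro ⟨hs, hA⟩
      have h1 : |x.1 - c.1| ≤ ℓ ∧ |x.2 - c.2| ≤ ℓ := by
        have := hs; rw [mem_sphere, Prod.dist_eq, Real.dist_eq, Real.dist_eq] at this
        exact ⟨le_of_max_le_left this.le, le_of_max_le_right this.le⟩
      refine ⟨hs, abs_le.2 ⟨by linarith, ?_⟩, h1.2.trans hNℓ.le⟩
      have := abs_le.1 h1.1
      have := le_abs_self (c.1 + ℓ - A)
      linarith
    · rintro ⟨hs, h1, -⟩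
      exact ⟨hs, by linarith [(abs_le.1 h1).1]⟩
  rw [heq] at hne ⊢
  exact isPathConnected_sphere_inter_closedBall hℓ hNℓ hne

/-- `{x ∈ sphere c ℓ | x.1 ≤ A}` is path connected when nonempty. [folklore] -/
theorem isPathConnected_sphere_inter_fst_le (hℓ : 0 < ℓ) (A : ℝ) (hne : (sphere c ℓ ∩ {x | x.1 ≤ A}).Nonempty) :
    IsPathConnected (sphere c ℓ ∩ {x | x.1 ≤ A}) := by
  set N : ℝ := ℓ + |c.1 - ℓ - A| + 1 with hN
  have hNℓ : ℓ < N := by have := abs_nonneg (c.1 - ℓ - A); linarith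
  have heq : sphere c ℓ ∩ {x | x.1 ≤ A} = sphere c ℓ ∩ closedBall ((A - N, c.2) : ℝ × ℝ) N := by
    ext x
    simp only [mem_inter_iff, mem_setOf_eq, mem_closedBall_iff_coord]
    constructor
    · rintro ⟨hs, hA⟩
      have h1 : |x.1 - c.1| ≤ ℓ ∧ |x.2 - c.2| ≤ ℓ := by
        have := hs; rw [mem_sphere, Prod.dist_eq, Real.dist_eq, Real.dist_eq] at this
        exact ⟨le_of_max_le_left this.le, le_of_max_le_right this.le⟩
      refine ⟨hs, abs_le.2 ⟨?_, by linarith⟩, h1.2.trans hNℓ.le⟩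
      have := abs_le.1 h1.1
      have := neg_abs_le (c.1 - ℓ - A)
      linarith
    · rintro ⟨hs, h1, -⟩
      exact ⟨hs, by linarith [(abs_le.1 h1).2]⟩
  rw [heq] at hne ⊢
  exact isPathConnected_sphere_inter_closedBall hℓ hNℓ hne

/-- `{x ∈ sphere c ℓ | A ≤ x.2}` is path connected when nonempty. [folklore] -/
theorem isPathConnected_sphere_inter_snd_ge (hℓ : 0 < ℓ) (A : ℝ) (hne : (sphere c ℓ ∩ {x | A ≤ x.2}).Nonempty) :
    IsPathConnected (sphere c ℓ ∩ {x | A ≤ x.2}) := by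
  set N : ℝ := ℓ + |c.2 + ℓ - A| + 1 with hN
  have hNℓ : ℓ < N := by have := abs_nonneg (c.2 + ℓ - A); linarith
  have heq : sphere c ℓ ∩ {x | A ≤ x.2} = sphere c ℓ ∩ closedBall ((c.1, A + N) : ℝ × ℝ) N := by
    ext x
    simp only [mem_inter_iff, mem_setOf_eq, mem_closedBall_iff_coord]
    constructor
    · rintro ⟨hs, hA⟩
      have h1 : |x.1 - c.1| ≤ ℓ ∧ |x.2 - c.2| ≤ ℓ := by
        have := hs; rw [mem_sphere, Prod.dist_eq, Real.dist_eq, Real.dist_eq] at this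
        exact ⟨le_of_max_le_left this.le, le_of_max_le_right this.le⟩
      refine ⟨hs, h1.1.trans hNℓ.le, abs_le.2 ⟨by linarith, ?_⟩⟩
      have := abs_le.1 h1.2
      have := le_abs_self (c.2 + ℓ - A)
      linarith
    · rintro ⟨hs, -, h1⟩
      exact ⟨hs, by linarith [(abs_le.1 h1).1]⟩
  rw [heq] at hne ⊢
  exact isPathConnected_sphere_inter_closedBall hℓ hNℓ hne

/-- `{x ∈ sphere c ℓ | x.2 ≤ A}` is path connected when nonempty. [folklore] -/
theorem isPathConnected_sphere_inter_snd_le (hℓ : 0 < ℓ) (A : ℝ) (hne : (sphere c ℓ ∩ {x | x.2 ≤ A}).Nonempty) :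
    IsPathConnected (sphere c ℓ ∩ {x | x.2 ≤ A}) := by
  set N : ℝ := ℓ + |c.2 - ℓ - A| + 1 with hN
  have hNℓ : ℓ < N := by have := abs_nonneg (c.2 - ℓ - A); linarith
  have heq : sphere c ℓ ∩ {x | x.2 ≤ A} = sphere c ℓ ∩ closedBall ((c.1, A - N) : ℝ × ℝ) N := by
    ext x
    simp only [mem_inter_iff, mem_setOf_eq, mem_closedBall_iff_coord]
    constructor
    · rintro ⟨hs, hA⟩
      have h1 : |x.1 - c.1| ≤ ℓ ∧ |x.2 - c.2| ≤ ℓ := by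
        have := hs; rw [mem_sphere, Prod.dist_eq, Real.dist_eq, Real.dist_eq] at this
        exact ⟨le_of_max_le_left this.le, le_of_max_le_right this.le⟩
      refine ⟨hs, h1.1.trans hNℓ.le, abs_le.2 ⟨?_, by linarith⟩⟩
      have := abs_le.1 h1.2
      have := neg_abs_le (c.2 - ℓ - A)
      linarith
    · rintro ⟨hs, -, h1⟩
      exact ⟨hs, by linarith [(abs_le.1 h1).2]⟩
  rw [heq] at hne ⊢
  exact isPathConnected_sphere_inter_closedBall hℓ hNℓ hne

/-- **The part of a boundary square outside a bigger open square is path connected** (when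
nonempty, half-side `ℓ < R`). [folklore] -/
theorem isPathConnected_sphere_diff_ball (hℓ : 0 < ℓ) (hR : ℓ < R) (hne : (sphere c ℓ ∩ (ball c₀ R)ᶜ).Nonempty) :
    IsPathConnected (sphere c ℓ ∩ (ball c₀ R)ᶜ) := by
  have hbd : ∀ x ∈ sphere c ℓ, |x.1 - c.1| ≤ ℓ ∧ |x.2 - c.2| ≤ ℓ := fun x hs ↦ by
    rw [mem_sphere, Prod.dist_eq, Real.dist_eq, Real.dist_eq] at hs
    exact ⟨le_of_max_le_left hs.le, le_of_max_le_right hs.le⟩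
  -- the four pieces
  set V : Bool → Set (ℝ × ℝ) := fun i ↦ if i then sphere c ℓ ∩ {x | c₀.1 + R ≤ x.1} else sphere c ℓ ∩ {x | x.1 ≤ c₀.1 - R}
    with hV
  set H : Bool → Set (ℝ × ℝ) := fun j ↦ if j then sphere c ℓ ∩ {x | c₀.2 + R ≤ x.2} else sphere c ℓ ∩ {x | x.2 ≤ c₀.2 - R}
    with hH
  have hVpre : ∀ i, (V i).Nonempty → IsPathConnected (V i) := fun i h ↦ by
    cases i
    · exact isPathConnected_sphere_inter_fst_le hℓ _ h
    · exact isPathConnected_sphere_inter_fst_ge hℓ _ h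
  have hHpre : ∀ j, (H j).Nonempty → IsPathConnected (H j) := fun j h ↦ by
    cases j
    · exact isPathConnected_sphere_inter_snd_le hℓ _ h
    · exact isPathConnected_sphere_inter_snd_ge hℓ _ h
  have heq : sphere c ℓ ∩ (ball c₀ R)ᶜ = (⋃ i, V i) ∪ ⋃ j, H j := by
    ext x
    simp only [mem_inter_iff, mem_compl_iff, mem_ball, Prod.dist_eq, Real.dist_eq, max_lt_iff, not_and_or, not_lt,
      mem_union, mem_iUnion, hV, hH]
    constructor
    · rintro ⟨hs, h | h⟩
      · left
        rcases le_abs'.1 h with h' | h'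
        · exact ⟨false, by simp only [Bool.false_eq_true, if_false]; exact ⟨hs, by show x.1 ≤ c₀.1 - R; linarith⟩⟩
        · exact ⟨true, by simp only [if_true]; exact ⟨hs, by show c₀.1 + R ≤ x.1; linarith⟩⟩
      · right
        rcases le_abs'.1 h with h' | h'
        · exact ⟨false, by simp only [Bool.false_eq_true, if_false]; exact ⟨hs, by show x.2 ≤ c₀.2 - R; linarith⟩⟩
        · exact ⟨true, by simp only [if_true]; exact ⟨hs, by show c₀.2 + R ≤ x.2; linarith⟩⟩
    · rintro (⟨i, h⟩ | ⟨j, h⟩)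
      · cases i
        · simp only [Bool.false_eq_true, if_false] at h
          exact ⟨h.1, Or.inl (le_abs.2 (Or.inr (by have : x.1 ≤ c₀.1 - R := h.2; linarith)))⟩
        · simp only [if_true] at h
          exact ⟨h.1, Or.inl (le_abs.2 (Or.inl (by have : c₀.1 + R ≤ x.1 := h.2; linarith)))⟩
      · cases j
        · simp only [Bool.false_eq_true, if_false] at h
          exact ⟨h.1, Or.inr (le_abs.2 (Or.inr (by have : x.2 ≤ c₀.2 - R := h.2; linarith)))⟩
        · simp only [if_true] at h
          exact ⟨h.1, Or.inr (le_abs.2 (Or.inl (by have : c₀.2 + R ≤ x.2 := h.2; linarith)))⟩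
  rw [heq]
  -- the corner of the square in the directions of nonempty pieces lies in both
  have hcorner : ∀ i j, (V i).Nonempty → (H j).Nonempty → (V i ∩ H j).Nonempty := by
    intro i j ⟨x, hx⟩ ⟨y, hy⟩
    set v : ℝ × ℝ := (if i then c.1 + ℓ else c.1 - ℓ, if j then c.2 + ℓ else c.2 - ℓ) with hv
    have hvs : v ∈ sphere c ℓ := by
      rw [mem_sphere_iff_coord]
      left
      constructor
      · cases i <;> simp [hv, abs_of_pos hℓ]
      · cases j <;> simp [hv, abs_of_pos hℓ]
    refine ⟨v, ?_, ?_⟩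
    · cases i
      · simp only [hV, Bool.false_eq_true, if_false] at hx ⊢
        refine ⟨hvs, ?_⟩
        show c.1 - ℓ ≤ c₀.1 - R
        have h1 := (abs_le.1 (hbd x hx.1).1).1; have h2 : x.1 ≤ c₀.1 - R := hx.2; linarith
      · simp only [hV, if_true] at hx ⊢
        refine ⟨hvs, ?_⟩
        show c₀.1 + R ≤ c.1 + ℓ
        have h1 := (abs_le.1 (hbd x hx.1).1).2; have h2 : c₀.1 + R ≤ x.1 := hx.2; linarith
    · cases j
      · simp only [hH, Bool.false_eq_true, if_false] at hy ⊢
        refine ⟨hvs, ?_⟩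
        show c.2 - ℓ ≤ c₀.2 - R
        have h1 := (abs_le.1 (hbd y hy.1).2).1; have h2 : y.2 ≤ c₀.2 - R := hy.2; linarith
      · simp only [hH, if_true] at hy ⊢
        refine ⟨hvs, ?_⟩
        show c₀.2 + R ≤ c.2 + ℓ
        have h1 := (abs_le.1 (hbd y hy.1).2).2; have h2 : c₀.2 + R ≤ y.2 := hy.2; linarith
  -- opposite pieces are not both nonempty
  have hoppV : ¬ ((V false).Nonempty ∧ (V true).Nonempty) := by
    rintro ⟨⟨x, hx⟩, ⟨y, hy⟩⟩
    simp only [hV, Bool.false_eq_true, if_false, if_true] at hx hy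
    have h1 := (abs_le.1 (hbd x hx.1).1).1; have h2 := (abs_le.1 (hbd y hy.1).1).2
    have h3 : x.1 ≤ c₀.1 - R := hx.2; have h4 : c₀.1 + R ≤ y.1 := hy.2
    linarith
  have hoppH : ¬ ((H false).Nonempty ∧ (H true).Nonempty) := by
    rintro ⟨⟨x, hx⟩, ⟨y, hy⟩⟩
    simp only [hH, Bool.false_eq_true, if_false, if_true] at hx hy
    have h1 := (abs_le.1 (hbd x hx.1).2).1; have h2 := (abs_le.1 (hbd y hy.1).2).2
    have h3 : x.2 ≤ c₀.2 - R := hx.2; have h4 : c₀.2 + R ≤ y.2 := hy.2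
    linarith
  -- assemble with `IsPathConnected.union`
  have hassemble : ∀ (i₀ : Bool) (j₀ : Bool), (V i₀).Nonempty → (H j₀).Nonempty →
      IsPathConnected ((⋃ i, V i) ∪ ⋃ j, H j) := by
    intro i₀ j₀ hi₀ hj₀
    have hP₀ : IsPathConnected (V i₀ ∪ H j₀) := (hVpre i₀ hi₀).union (hHpre j₀ hj₀) (hcorner i₀ j₀ hi₀ hj₀)
    have hP₁ : IsPathConnected ((V i₀ ∪ H j₀) ∪ V (!i₀)) := by
      refine IsPathConnected.union_of_subset_or hP₀ ?_
      by_cases h : (V (!i₀)).Nonempty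
      · right
        obtain ⟨z, hzV, hzH⟩ := hcorner (!i₀) j₀ h hj₀
        exact ⟨hVpre _ h, ⟨z, Or.inr hzH, hzV⟩⟩
      · exact Or.inl (not_nonempty_iff_eq_empty.1 h)
    have hP₂ : IsPathConnected (((V i₀ ∪ H j₀) ∪ V (!i₀)) ∪ H (!j₀)) := by
      refine IsPathConnected.union_of_subset_or hP₁ ?_
      by_cases h : (H (!j₀)).Nonempty
      · right
        obtain ⟨z, hzV, hzH⟩ := hcorner i₀ (!j₀) hi₀ h
        exact ⟨hHpre _ h, ⟨z, Or.inl (Or.inl hzV), hzH⟩⟩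
      · exact Or.inl (not_nonempty_iff_eq_empty.1 h)
    have hunion : (((V i₀ ∪ H j₀) ∪ V (!i₀)) ∪ H (!j₀)) = (⋃ i, V i) ∪ ⋃ j, H j := by
      apply Subset.antisymm
      · rintro y (((hy | hy) | hy) | hy)
        · exact Or.inl (mem_iUnion.2 ⟨_, hy⟩)
        · exact Or.inr (mem_iUnion.2 ⟨_, hy⟩)
        · exact Or.inl (mem_iUnion.2 ⟨_, hy⟩)
        · exact Or.inr (mem_iUnion.2 ⟨_, hy⟩)
      · rintro y (hy | hy)
        · obtain ⟨i, hy⟩ := mem_iUnion.1 hy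
          by_cases hi : i = i₀
          · subst hi; exact Or.inl (Or.inl (Or.inl hy))
          · have : i = !i₀ := by cases i <;> cases i₀ <;> simp at hi ⊢
            subst this; exact Or.inl (Or.inr hy)
        · obtain ⟨j, hy⟩ := mem_iUnion.1 hy
          by_cases hj : j = j₀
          · subst hj; exact Or.inl (Or.inl (Or.inr hy))
          · have : j = !j₀ := by cases j <;> cases j₀ <;> simp at hj ⊢
            subst this; exact Or.inr hy
    rw [← hunion]; exact hP₂
  by_cases hVne : ∃ i, (V i).Nonempty
  · by_cases hHne : ∃ j, (H j).Nonempty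
    · obtain ⟨i₀, hi₀⟩ := hVne
      obtain ⟨j₀, hj₀⟩ := hHne
      exact hassemble i₀ j₀ hi₀ hj₀
    · push Not at hHne
      have hH0 : (⋃ j, H j) = ∅ := by rw [iUnion_eq_empty]; exact hHne
      rw [hH0, union_empty]
      obtain ⟨i₀, hi₀⟩ := hVne
      have hother : V (!i₀) = ∅ := by
        apply not_nonempty_iff_eq_empty.1
        intro h
        cases i₀
        · exact hoppV ⟨hi₀, h⟩
        · exact hoppV ⟨h, hi₀⟩
      have hU : (⋃ i, V i) = V i₀ := by
        apply Subset.antisymm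
        · refine iUnion_subset fun i ↦ ?_
          by_cases hi : i = i₀
          · rw [hi]
          · have : i = !i₀ := by cases i <;> cases i₀ <;> simp at hi ⊢
            rw [this, hother]; exact empty_subset _
        · exact subset_iUnion V i₀
      rw [hU]; exact hVpre i₀ hi₀
  · push Not at hVne
    have hV0 : (⋃ i, V i) = ∅ := by rw [iUnion_eq_empty]; exact hVne
    rw [hV0, empty_union]
    by_cases hHne : ∃ j, (H j).Nonempty
    · obtain ⟨j₀, hj₀⟩ := hHne
      have hother : H (!j₀) = ∅ := by
        apply not_nonempty_iff_eq_empty.1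
        intro h
        cases j₀
        · exact hoppH ⟨hj₀, h⟩
        · exact hoppH ⟨h, hj₀⟩
      have hU : (⋃ j, H j) = H j₀ := by
        apply Subset.antisymm
        · refine iUnion_subset fun j ↦ ?_
          by_cases hj : j = j₀
          · rw [hj]
          · have : j = !j₀ := by cases j <;> cases j₀ <;> simp at hj ⊢
            rw [this, hother]; exact empty_subset _
        · exact subset_iUnion H j₀
      rw [hU]; exact hHpre j₀ hj₀
    · -- everything empty: contradicts nonemptiness
      exfalso
      push Not at hHne
      obtain ⟨x, hx⟩ := hne
      rw [heq] at hx
      rcases hx with hx | hx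
      · rw [hV0] at hx; exact hx
      · have hH0 : (⋃ j, H j) = ∅ := by rw [iUnion_eq_empty]; exact hHne
        rw [hH0] at hx; exact hx

/-! ## Path-connected contour lines of radial squares -/

section Radial

variable {m : ℝ} {ψ : ℝ × ℝ → ℝ} {Ψ : ℝ → ℝ} {K : Set ℝ} {R' : ℝ}

/-- **The contour line of a radial roof square at the height of the radius `R'` is path
connected** (when nonempty). [folklore] -/
theorem IsRadial.isPathConnected_levelLine (hrad : IsRadial c₀ c ℓ ψ Ψ K) (hℓ : 0 < ℓ) (hR : R' ∈ K) (hℓR : ℓ < R')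
    (hm : ∀ q ∈ sphere c ℓ, ψ q < m) (hh : Ψ R' < m) (hψ : ContinuousOn ψ (sphere c ℓ))
    (hne : (levelLine c ℓ m ψ (Ψ R')).Nonempty) : IsPathConnected (levelLine c ℓ m ψ (Ψ R')) := by
  rw [levelLine_eq_image hℓ hm hh] at hne ⊢
  have hne' : {q | q ∈ sphere c ℓ ∧ ψ q ≤ Ψ R'}.Nonempty := by
    obtain ⟨_, ⟨q, hq, rfl⟩⟩ := hne; exact ⟨q, hq⟩
  -- the sub-level arc is a big-square piece or a complement piece
  have hin : {q | q ∈ sphere c ℓ ∧ dist q c₀ ≤ R'} = sphere c ℓ ∩ closedBall c₀ R' := by ext q; simp [mem_closedBall]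
  have hout : {q | q ∈ sphere c ℓ ∧ R' ≤ dist q c₀} = sphere c ℓ ∩ (ball c₀ R')ᶜ := by ext q; simp [mem_ball, not_lt]
  have harc : IsPathConnected {q | q ∈ sphere c ℓ ∧ ψ q ≤ Ψ R'} := by
    rcases hrad.mono with hmono | hanti
    · have h1 : {q | q ∈ sphere c ℓ ∧ ψ q ≤ Ψ R'} = {q | q ∈ sphere c ℓ ∧ dist q c₀ ≤ R'} := by
        ext q; constructor
        · rintro ⟨hq, h⟩; exact ⟨hq, (hmono.le_iff_le (hrad.mem q hq) hR).1 (by rw [← hrad.eq q hq]; exact h)⟩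
        · rintro ⟨hq, h⟩; exact ⟨hq, by rw [hrad.eq q hq]; exact (hmono.le_iff_le (hrad.mem q hq) hR).2 h⟩
      rw [h1, hin] at hne' ⊢
      exact isPathConnected_sphere_inter_closedBall hℓ hℓR hne'
    · have h1 : {q | q ∈ sphere c ℓ ∧ ψ q ≤ Ψ R'} = {q | q ∈ sphere c ℓ ∧ R' ≤ dist q c₀} := by
        ext q; constructor
        · rintro ⟨hq, h⟩; exact ⟨hq, (StrictAntiOn.le_iff_ge hanti (hrad.mem q hq) hR).1 (by rw [← hrad.eq q hq]; exact h)⟩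
        · rintro ⟨hq, h⟩; exact ⟨hq, by rw [hrad.eq q hq]; exact (StrictAntiOn.le_iff_ge hanti (hrad.mem q hq) hR).2 h⟩
      rw [h1, hout] at hne' ⊢
      exact isPathConnected_sphere_diff_ball hℓ hℓR hne'
  exact harc.image' ((continuousOn_levelPt_sphere hm hψ).mono fun q hq ↦ hq.1)

/-- The same for a radial floor square. [folklore] -/
theorem IsRadial.isPathConnected_levelLine_floor (hrad : IsRadial c₀ c ℓ ψ Ψ K) (hℓ : 0 < ℓ) (hR : R' ∈ K) (hℓR : ℓ < R')
    (hm : ∀ q ∈ sphere c ℓ, m < ψ q) (hh : m < Ψ R') (hψ : ContinuousOn ψ (sphere c ℓ))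
    (hne : (levelLine c ℓ m ψ (Ψ R')).Nonempty) : IsPathConnected (levelLine c ℓ m ψ (Ψ R')) := by
  rw [levelLine_eq_image_floor hℓ hm hh] at hne ⊢
  have hne' : {q | q ∈ sphere c ℓ ∧ Ψ R' ≤ ψ q}.Nonempty := by
    obtain ⟨_, ⟨q, hq, rfl⟩⟩ := hne; exact ⟨q, hq⟩
  have hin : {q | q ∈ sphere c ℓ ∧ dist q c₀ ≤ R'} = sphere c ℓ ∩ closedBall c₀ R' := by ext q; simp [mem_closedBall]
  have hout : {q | q ∈ sphere c ℓ ∧ R' ≤ dist q c₀} = sphere c ℓ ∩ (ball c₀ R')ᶜ := by ext q; simp [mem_ball, not_lt]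
  have harc : IsPathConnected {q | q ∈ sphere c ℓ ∧ Ψ R' ≤ ψ q} := by
    rcases hrad.mono with hmono | hanti
    · have h2 : {q | q ∈ sphere c ℓ ∧ Ψ R' ≤ ψ q} = {q | q ∈ sphere c ℓ ∧ R' ≤ dist q c₀} := by
        ext q; constructor
        · rintro ⟨hq, h⟩; exact ⟨hq, (hmono.le_iff_le hR (hrad.mem q hq)).1 (by rw [← hrad.eq q hq]; exact h)⟩
        · rintro ⟨hq, h⟩; exact ⟨hq, by rw [hrad.eq q hq]; exact (hmono.le_iff_le hR (hrad.mem q hq)).2 h⟩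
      rw [h2, hout] at hne' ⊢
      exact isPathConnected_sphere_diff_ball hℓ hℓR hne'
    · have h2 : {q | q ∈ sphere c ℓ ∧ Ψ R' ≤ ψ q} = {q | q ∈ sphere c ℓ ∧ dist q c₀ ≤ R'} := by
        ext q; constructor
        · rintro ⟨hq, h⟩; exact ⟨hq, (StrictAntiOn.le_iff_ge hanti hR (hrad.mem q hq)).1 (by rw [← hrad.eq q hq]; exact h)⟩
        · rintro ⟨hq, h⟩; exact ⟨hq, by rw [hrad.eq q hq]; exact (StrictAntiOn.le_iff_ge hanti hR (hrad.mem q hq)).2 h⟩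
      rw [h2, hin] at hne' ⊢
      exact isPathConnected_sphere_inter_closedBall hℓ hℓR hne'
  exact harc.image' ((continuousOn_levelPt_sphere_floor hm hψ).mono fun q hq ↦ hq.1)

end Radial

end ConeSquare

end Literature.Topology.FourManifolds
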